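import Summits.QuantumAdvantage.QuantumAdvantage.Theses.LinnikCubicClassGroups
import Literature.NumberTheory.CubicFields.VoronoiRelativeMinima
import Literature.NumberTheory.CubicFields.VoronoiChain

/-!
# Crux `LinnikCubicClassGroups.PureCubicClassGroupFBQP` (stmt-QuantumAdvantage-11544)

Stub `stub_voronoiChain` (S3a) of the line `arakelov-giant-step-cycle`.

THE VORONOI CHAIN OF A FRACTIONAL IDEAL OF A CUBIC FIELD OF SIGNATURE (1,1). The number theory
(relative minima, the successor, the two-sided chain `voronoiChain σ₁ σ₂ I x₀ : ℤ → K` through a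
positive relative minimum `x₀` and its completeness) is the Literature pair
`Literature/NumberTheory/CubicFields/VoronoiRelativeMinima.lean`, `…/VoronoiChain.lean`
(Voronoi 1896; Delone–Faddeev 1964, Ch. IV). Here:

* `voronoiChain_periodic`, `voronoiChain_shift_pos` — a unit `u` with `σ₁ u > 0` shifts the chain
  by a constant `c` (`θ (i + c) = u θ i`), and `c > 0` when `σ₁ u > 1`;
* `voronoiChain_six_gap` — the SIX-GAP `σ₁ θ(i+6) ≥ 2 σ₁ θ(i)` from the packing hypothesis h1
  (= S1 `stub_packing`: at most six relative minima have `σ₁` in one dyadic range; seven consecutive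
  chain elements in `[t, 2t)` would contradict it);
* `voronoi_exists_short`, `voronoiChain_gap_le` — Minkowski in the normed body
  (`NumberField.mixedEmbedding.exists_ne_zero_mem_ideal_lt`, with `|N t| ≥ N(I)` for `t ∈ I`,
  `voronoi_absNorm_le_abs_norm`): `σ₁ θ(i+1) ≤ (2√|d_K|/π + 1) σ₁ θ(i) ≤ 3 √|d_K| σ₁ θ(i)`;
* `stub_voronoiChain` — the registered statement, from h1 (packing) and h2 (= S2
  `stub_regulatorPeriod`: the least unit `ε` with `σ₁ ε > 1`, `log σ₁ ε = regulator K`).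
-/

namespace Summit.QuantumAdvantage.QuantumAdvantage.Theorems.LinnikCubicClassGroups

open scoped NumberField ComplexConjugate
open NumberField
open Literature.NumberTheory.CubicFields

section Period

variable {K : Type} [Field K] [NumberField K] {σ₁ : K →+* ℝ} {σ₂ : K →+* ℂ}
  {I : FractionalIdeal (nonZeroDivisors (𝓞 K)) K}
variable (hdeg : Module.finrank ℚ K = 3) (hσ₂ : ∃ z : K, starRingEnd ℂ (σ₂ z) ≠ σ₂ z)
  (ε : (𝓞 K)ˣ) (hε : 1 < σ₁ (algebraMap (𝓞 K) K ε))

include hdeg hσ₂ hε in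
/-- `voronoiSucc` is injective on the positive minima. -/
theorem voronoiSucc_injOn {μ μ' : K} (hμ : μ ∈ posRelMinima σ₁ σ₂ I) (hμ' : μ' ∈ posRelMinima σ₁ σ₂ I)
    (h : voronoiSucc σ₁ σ₂ I μ = voronoiSucc σ₁ σ₂ I μ') : μ = μ' := by
  rw [← voronoiPred_succ hdeg hσ₂ ε hε hμ, ← voronoiPred_succ hdeg hσ₂ ε hε hμ', h]

include hdeg hσ₂ hε in
/-- **Periodicity of the chain under a positive unit**: multiplication by `u` shifts the chain by a
constant. -/
theorem voronoiChain_periodic {x₀ : K} (hx₀ : x₀ ∈ posRelMinima σ₁ σ₂ I) (u : (𝓞 K)ˣ) (hu : 0 < σ₁ (algebraMap (𝓞 K) K u)) :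
    ∃ c : ℤ, ∀ i : ℤ, voronoiChain σ₁ σ₂ I x₀ (i + c) = algebraMap (𝓞 K) K u * voronoiChain σ₁ σ₂ I x₀ i := by
  obtain ⟨c, hc⟩ := exists_voronoiChain_eq hdeg hσ₂ ε hε hx₀ (unit_mul_mem_posRelMinima hx₀ u hu)
  refine ⟨c, fun i => ?_⟩
  induction i with
  | zero => rw [zero_add, hc, voronoiChain_zero]
  | succ i ih =>
    rw [voronoiChain_succ hdeg hσ₂ ε hε hx₀, ← voronoiSucc_unit_mul hdeg hσ₂ ε hε (voronoiChain_mem hdeg hσ₂ ε hε hx₀ i) u hu, ← ih,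
      show (i : ℤ) + 1 + c = (i + c) + 1 by ring, voronoiChain_succ hdeg hσ₂ ε hε hx₀]
  | pred i ih =>
    apply voronoiSucc_injOn hdeg hσ₂ ε hε (voronoiChain_mem hdeg hσ₂ ε hε hx₀ _)
      (unit_mul_mem_posRelMinima (voronoiChain_mem hdeg hσ₂ ε hε hx₀ _) u hu)
    rw [← voronoiChain_succ hdeg hσ₂ ε hε hx₀, voronoiSucc_unit_mul hdeg hσ₂ ε hε (voronoiChain_mem hdeg hσ₂ ε hε hx₀ _) u hu, ← voronoiChain_succ hdeg hσ₂ ε hε hx₀,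
      show -(i : ℤ) - 1 + c + 1 = -i + c by ring, show -(i : ℤ) - 1 + 1 = -i by ring, ih]

include hdeg hσ₂ hε in
/-- The shift of a unit with `σ₁ > 1` is positive. -/
theorem voronoiChain_shift_pos {x₀ : K} (hx₀ : x₀ ∈ posRelMinima σ₁ σ₂ I) (u : (𝓞 K)ˣ) (hu : 1 < σ₁ (algebraMap (𝓞 K) K u)) {c : ℤ}
    (hc : ∀ i : ℤ, voronoiChain σ₁ σ₂ I x₀ (i + c) = algebraMap (𝓞 K) K u * voronoiChain σ₁ σ₂ I x₀ i) :
    0 < c := by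
  have h0 := hc 0
  rw [zero_add] at h0
  have hlt : σ₁ (voronoiChain σ₁ σ₂ I x₀ 0) < σ₁ (voronoiChain σ₁ σ₂ I x₀ c) := by
    rw [h0, map_mul]
    have hp : 0 < σ₁ (voronoiChain σ₁ σ₂ I x₀ 0) := (voronoiChain_mem hdeg hσ₂ ε hε hx₀ 0).2
    nlinarith
  exact (voronoiChain_strictMono hdeg hσ₂ ε hε hx₀).lt_iff_lt.mp hlt

include hdeg hσ₂ hε in
/-- **The six-gap** (from the packing of S1 `stub_packing`): six steps along the chain at least
double the real conjugate. -/
theorem voronoiChain_six_gap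
    (h1 : ∀ (K : Type) [Field K] (σ₁ : K →+* ℝ) (σ₂ : K →+* ℂ) (L : AddSubgroup K) (t : ℝ),
      0 < t → Set.encard {θ : K | θ ∈ L ∧ θ ≠ 0 ∧
        (∀ φ ∈ L, φ ≠ 0 → |σ₁ φ| < |σ₁ θ| → ‖σ₂ θ‖ ≤ ‖σ₂ φ‖) ∧ t ≤ σ₁ θ ∧ σ₁ θ < 2 * t} ≤ 6)
    {x₀ : K} (hx₀ : x₀ ∈ posRelMinima σ₁ σ₂ I) (i : ℤ) :
    2 * σ₁ (voronoiChain σ₁ σ₂ I x₀ i) ≤ σ₁ (voronoiChain σ₁ σ₂ I x₀ (i + 6)) := by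
  by_contra hcon
  push Not at hcon
  set t : ℝ := σ₁ (voronoiChain σ₁ σ₂ I x₀ i) with ht
  have ht0 : 0 < t := (voronoiChain_mem hdeg hσ₂ ε hε hx₀ i).2
  set L : AddSubgroup K := (I : Submodule (𝓞 K) K).toAddSubgroup with hL
  have hmemL : ∀ x : K, x ∈ L ↔ x ∈ I := fun x => by
    rw [hL, Submodule.mem_toAddSubgroup, FractionalIdeal.mem_coe]
  have h6 := h1 K σ₁ σ₂ L t ht0
  set S : Set K := {θ : K | θ ∈ L ∧ θ ≠ 0 ∧
    (∀ φ ∈ L, φ ≠ 0 → |σ₁ φ| < |σ₁ θ| → ‖σ₂ θ‖ ≤ ‖σ₂ φ‖) ∧ t ≤ σ₁ θ ∧ σ₁ θ < 2 * t} with hS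
  have hmono := (voronoiChain_strictMono hdeg hσ₂ ε hε hx₀).monotone
  have hmaps : Set.MapsTo (fun j : Fin 7 => voronoiChain σ₁ σ₂ I x₀ (i + (j : ℕ)))
      ((Finset.univ : Finset (Fin 7)) : Set (Fin 7)) S := by
    intro j _
    have hm := voronoiChain_mem hdeg hσ₂ ε hε hx₀ (i + (j : ℕ))
    refine ⟨(hmemL _).mpr hm.1.1, hm.1.2.1, fun φ hφ h0 hlt => hm.1.2.2 φ ((hmemL φ).mp hφ) h0 hlt, ?_, ?_⟩
    · exact hmono (show i ≤ i + (j : ℕ) by omega)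
    · have hj : (j : ℕ) ≤ 6 := Nat.lt_succ_iff.mp j.isLt
      exact lt_of_le_of_lt (hmono (show i + (j : ℕ) ≤ i + 6 by omega)) hcon
  have hinj : Set.InjOn (fun j : Fin 7 => voronoiChain σ₁ σ₂ I x₀ (i + (j : ℕ)))
      ((Finset.univ : Finset (Fin 7)) : Set (Fin 7)) := by
    intro a _ b _ hab
    have h := congrArg σ₁ hab
    have := (voronoiChain_strictMono hdeg hσ₂ ε hε hx₀).injective h
    exact Fin.ext (by omega)
  have h7 := Set.encard_le_encard_of_injOn hmaps hinj
  rw [Set.encard_coe_eq_coe_finsetCard, Finset.card_univ, Fintype.card_fin] at h7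
  have h76 := h7.trans h6
  norm_num at h76

end Period

section Minkowski

variable {K : Type} [Field K] [NumberField K] {σ₁ : K →+* ℝ} {σ₂ : K →+* ℂ}
  {I : FractionalIdeal (nonZeroDivisors (𝓞 K)) K}

/-- **Containment bounds the norm**: a nonzero element of a nonzero fractional ideal has
`|N(t)| ≥ N(I)`. -/
theorem voronoi_absNorm_le_abs_norm (hI : I ≠ 0) {t : K} (ht : t ∈ I) (ht0 : t ≠ 0) :
    ((FractionalIdeal.absNorm I : ℚ) : ℝ) ≤ |((Algebra.norm ℚ t : ℚ) : ℝ)| := by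
  classical
  set J : FractionalIdeal (nonZeroDivisors (𝓞 K)) K := FractionalIdeal.spanSingleton _ t with hJ
  have hJle : J ≤ I := FractionalIdeal.spanSingleton_le_iff_mem.mpr ht
  have hJ0 : J ≠ 0 := by rw [hJ, Ne, FractionalIdeal.spanSingleton_eq_zero_iff]; exact ht0
  have hdecomp : J = I * (I⁻¹ * J) := by rw [← mul_assoc, mul_inv_cancel₀ hI, one_mul]
  have hle1 : I⁻¹ * J ≤ 1 := by
    calc I⁻¹ * J ≤ I⁻¹ * I := by gcongr
      _ = 1 := inv_mul_cancel₀ hI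
  obtain ⟨B, hB⟩ := FractionalIdeal.le_one_iff_exists_coeIdeal.mp hle1
  have hB0 : B ≠ ⊥ := by
    intro h
    rw [h, FractionalIdeal.coeIdeal_bot] at hB
    have : I⁻¹ * J = 0 := hB.symm
    rcases mul_eq_zero.mp this with h' | h'
    · exact (inv_ne_zero hI) h'
    · exact hJ0 h'
  have hNB : (1 : ℚ) ≤ FractionalIdeal.absNorm (I⁻¹ * J) := by
    rw [← hB, FractionalIdeal.coeIdeal_absNorm]
    have : 1 ≤ Ideal.absNorm B := Nat.one_le_iff_ne_zero.mpr (by rwa [Ne, Ideal.absNorm_eq_zero_iff])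
    exact_mod_cast this
  have hNJ : FractionalIdeal.absNorm J = |Algebra.norm ℚ t| := by
    rw [hJ]; exact FractionalIdeal.absNorm_span_singleton (𝓞 K) t
  have key : FractionalIdeal.absNorm I ≤ FractionalIdeal.absNorm J := by
    conv_rhs => rw [hdecomp]
    rw [map_mul]
    have h0 : 0 ≤ FractionalIdeal.absNorm I := FractionalIdeal.absNorm_nonneg I
    nlinarith
  rw [hNJ] at key
  have : ((FractionalIdeal.absNorm I : ℚ) : ℝ) ≤ ((|Algebra.norm ℚ t| : ℚ) : ℝ) := by exact_mod_cast key
  simpa [Rat.cast_abs] using this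

variable (hdeg : Module.finrank ℚ K = 3) (hσ₂ : ∃ z : K, starRingEnd ℂ (σ₂ z) ≠ σ₂ z)
  (ε : (𝓞 K)ˣ) (hε : 1 < σ₁ (algebraMap (𝓞 K) K ε))

include hdeg hσ₂ in
/-- Signature (1,1): the two infinite voronoi_places, their multiplicities and the Minkowski factors. -/
theorem voronoi_places (σ₁ : K →+* ℝ) :
    ∃ w₁ w₂ : InfinitePlace K, w₁.IsReal ∧ w₂.IsComplex ∧ w₁ ≠ w₂ ∧
      (∀ w : InfinitePlace K, w = w₁ ∨ w = w₂) ∧ (∀ x, w₁ x = |σ₁ x|) ∧ (∀ x, w₂ x = ‖σ₂ x‖) ∧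
      NumberField.InfinitePlace.nrRealPlaces K = 1 ∧ NumberField.InfinitePlace.nrComplexPlaces K = 1 := by
  classical
  set w₁ : InfinitePlace K := InfinitePlace.mk ((algebraMap ℝ ℂ).comp σ₁) with hw₁
  set w₂ : InfinitePlace K := InfinitePlace.mk σ₂ with hw₂
  have h1 : w₁.IsReal := by
    rw [hw₁, InfinitePlace.isReal_mk_iff, ComplexEmbedding.isReal_iff]
    exact conjugate_ofReal_comp σ₁
  have h2 : w₂.IsComplex := by
    rw [hw₂, InfinitePlace.isComplex_mk_iff, ComplexEmbedding.isReal_iff]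
    exact conjugate_ne_self σ₂ hσ₂
  have hne : w₁ ≠ w₂ := fun h => by
    rw [h] at h1; exact (InfinitePlace.not_isReal_iff_isComplex.mpr h2) h1
  have hsig : NumberField.InfinitePlace.nrRealPlaces K = 1 ∧ NumberField.InfinitePlace.nrComplexPlaces K = 1 := by
    have h := NumberField.InfinitePlace.card_add_two_mul_card_eq_rank K
    rw [hdeg] at h
    have hc : 0 < NumberField.InfinitePlace.nrComplexPlaces K := Fintype.card_pos_iff.mpr ⟨⟨w₂, h2⟩⟩
    have hr : 0 < NumberField.InfinitePlace.nrRealPlaces K := Fintype.card_pos_iff.mpr ⟨⟨w₁, h1⟩⟩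
    omega
  have hcard : Fintype.card (InfinitePlace K) = 2 := by
    rw [NumberField.InfinitePlace.card_eq_nrRealPlaces_add_nrComplexPlaces, hsig.1, hsig.2]
  have huniv : (Finset.univ : Finset (InfinitePlace K)) = {w₁, w₂} := by
    symm; apply Finset.eq_univ_of_card
    rw [hcard, Finset.card_pair hne]
  have hall : ∀ w : InfinitePlace K, w = w₁ ∨ w = w₂ := fun w => by
    have hw := Finset.mem_univ w
    rw [huniv] at hw
    simpa using hw
  refine ⟨w₁, w₂, h1, h2, hne, hall, fun x => ?_, fun x => ?_, hsig.1, hsig.2⟩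
  · rw [hw₁, InfinitePlace.apply]
    simp [Complex.norm_real]
  · rw [hw₂, InfinitePlace.apply]

include hdeg hσ₂ in
/-- **Minkowski in the normed body**: for `t ∈ I` nonzero there is a nonzero `a ∈ I` with
`|σ₁ a| < (2√|d_K|/π + 1) σ₁ t` hm and `‖σ₂ a‖ < ‖σ₂ t‖` — provided `σ₁ t > 0`. -/
theorem voronoi_exists_short (hI : I ≠ 0) {t : K} (ht : t ∈ I) (ht0 : t ≠ 0) (htpos : 0 < σ₁ t) :
    ∃ a ∈ I, a ≠ 0 ∧ |σ₁ a| < (2 * Real.sqrt |(NumberField.discr K : ℝ)| / Real.pi + 1) * σ₁ t ∧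
      ‖σ₂ a‖ < ‖σ₂ t‖ := by
  classical
  obtain ⟨w₁, w₂, hw₁, hw₂, hne, hall, hw₁x, hw₂x, hr, hc⟩ := voronoi_places hdeg hσ₂ σ₁
  have huniv : (Finset.univ : Finset (InfinitePlace K)) = {w₁, w₂} := by
    ext w; simpa using hall w
  set X : ℝ := 2 * Real.sqrt |(NumberField.discr K : ℝ)| / Real.pi + 1 with hX
  have hX0 : 0 < X := by positivity
  have hσt : 0 < ‖σ₂ t‖ := norm_pos_iff.mpr ((map_ne_zero σ₂).mpr ht0)
  set f : InfinitePlace K → NNReal := fun w => if w = w₁ then (X * σ₁ t).toNNReal else ‖σ₂ t‖₊ with hf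
  set I₁ : (FractionalIdeal (nonZeroDivisors (𝓞 K)) K)ˣ := Units.mk0 I hI with hI₁
  -- the norm of `t` dominates the norm of `I`
  have hNt : ((FractionalIdeal.absNorm I : ℚ) : ℝ) ≤ σ₁ t * ‖σ₂ t‖ ^ 2 := by
    have h := voronoi_absNorm_le_abs_norm hI ht ht0
    rw [norm_eq_mul_norm_sq σ₁ σ₂ hdeg hσ₂ t, abs_of_pos (by positivity)] at h
    exact h
  have hNI : 0 < ((FractionalIdeal.absNorm I : ℚ) : ℝ) := by
    have h0 : FractionalIdeal.absNorm I ≠ 0 := fun h => hI (FractionalIdeal.absNorm_eq_zero_iff.mp h)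
    have := lt_of_le_of_ne (FractionalIdeal.absNorm_nonneg I) (Ne.symm h0)
    exact_mod_cast this
  -- Minkowski's hypothesis
  have hvol : NumberField.mixedEmbedding.minkowskiBound K I₁ <
      MeasureTheory.volume (NumberField.mixedEmbedding.convexBodyLT K f) := by
    rw [NumberField.mixedEmbedding.convexBodyLT_volume, huniv,
      Finset.prod_pair (f := fun w : InfinitePlace K => f w ^ w.mult) hne]
    have hm1 : w₁.mult = 1 := by rw [NumberField.InfinitePlace.mult, if_pos hw₁]
    have hm2 : w₂.mult = 2 := by
      rw [NumberField.InfinitePlace.mult, if_neg (InfinitePlace.not_isReal_iff_isComplex.mpr hw₂)]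
    have hf1 : f w₁ = (X * σ₁ t).toNNReal := by simp [hf]
    have hf2 : f w₂ = ‖σ₂ t‖₊ := by simp [hf, hne.symm]
    rw [hm1, hm2, hf1, hf2, pow_one]
    -- both sides are finite: compare the real values
    rw [← ENNReal.toReal_lt_toReal (NumberField.mixedEmbedding.minkowskiBound_lt_top K I₁).ne
      (ENNReal.mul_ne_top ENNReal.coe_ne_top ENNReal.coe_ne_top)]
    have hLHS : (NumberField.mixedEmbedding.minkowskiBound K I₁).toReal =
        FractionalIdeal.absNorm I * ((2 : ℝ)⁻¹ * Real.sqrt |(NumberField.discr K : ℝ)|) * 2 ^ 3 := by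
      simp_rw [NumberField.mixedEmbedding.minkowskiBound,
        NumberField.mixedEmbedding.volume_fundamentalDomain_fractionalIdealLatticeBasis,
        NumberField.mixedEmbedding.volume_fundamentalDomain_latticeBasis, ENNReal.toReal_mul, ENNReal.toReal_pow,
        ENNReal.toReal_inv, ENNReal.coe_toReal, ENNReal.toReal_ofNat, NumberField.mixedEmbedding.finrank]
      rw [ENNReal.toReal_ofReal (Rat.cast_nonneg.mpr (FractionalIdeal.absNorm_nonneg _)), hI₁, Units.val_mk0, hc,
        hdeg, Real.coe_sqrt, coe_nnnorm, Int.norm_eq_abs, pow_one]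
    have hRHS : ((NumberField.mixedEmbedding.convexBodyLTFactor K : ENNReal) *
        (((X * σ₁ t).toNNReal * ‖σ₂ t‖₊ ^ 2 : NNReal) : ENNReal)).toReal =
        2 * Real.pi * (X * σ₁ t * ‖σ₂ t‖ ^ 2) := by
      rw [ENNReal.toReal_mul, ENNReal.coe_toReal, ENNReal.coe_toReal]
      have hXt : ((X * σ₁ t).toNNReal : ℝ) = X * σ₁ t := Real.coe_toNNReal _ (by positivity)
      simp only [NumberField.mixedEmbedding.convexBodyLTFactor, NNReal.coe_mul, NNReal.coe_pow, hXt, coe_nnnorm,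
        NNReal.coe_real_pi, NNReal.coe_ofNat, hr, hc, pow_one]
    rw [hLHS, hRHS]
    -- `4 N(I) √Δ < (4√Δ + 2π) N(t)`, from `N(I) ≤ σ₁ t ‖σ₂ t‖² = N(t)`
    have hsq : 0 ≤ Real.sqrt |(NumberField.discr K : ℝ)| := Real.sqrt_nonneg _
    have hpi : 0 < Real.pi := Real.pi_pos
    have e : 2 * Real.pi * (X * σ₁ t * ‖σ₂ t‖ ^ 2) =
        (4 * Real.sqrt |(NumberField.discr K : ℝ)| + 2 * Real.pi) * (σ₁ t * ‖σ₂ t‖ ^ 2) := by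
      rw [hX]; field_simp; ring
    rw [e]
    nlinarith
  obtain ⟨a, ha, ha0, hlt⟩ := NumberField.mixedEmbedding.exists_ne_zero_mem_ideal_lt K I₁ hvol
  have haI : a ∈ I := by simpa [hI₁] using ha
  refine ⟨a, haI, ha0, ?_, ?_⟩
  · have h := hlt w₁
    rw [hw₁x] at h
    have hf1 : ((f w₁ : NNReal) : ℝ) = X * σ₁ t := by simp [hf, Real.coe_toNNReal _ (by positivity : 0 ≤ X * σ₁ t)]
    rw [hf1] at h; exact h
  · have h := hlt w₂
    rw [hw₂x] at h
    have hf2 : ((f w₂ : NNReal) : ℝ) = ‖σ₂ t‖ := by simp [hf, hne.symm]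
    rw [hf2] at h; exact h

include hdeg hσ₂ hε in
/-- **The gap bound**: one step of the chain multiplies the real conjugate by at most `3 √|d_K|`. -/
theorem voronoiChain_gap_le (hI : I ≠ 0) {x₀ : K} (hx₀ : x₀ ∈ posRelMinima σ₁ σ₂ I) (i : ℤ) :
    σ₁ (voronoiChain σ₁ σ₂ I x₀ (i + 1)) ≤ 3 * Real.sqrt |(NumberField.discr K : ℝ)| * σ₁ (voronoiChain σ₁ σ₂ I x₀ i) := by
  have ht := voronoiChain_mem hdeg hσ₂ ε hε hx₀ i
  obtain ⟨a, haI, ha0, h1, h2⟩ := voronoi_exists_short hdeg hσ₂ hI ht.1.1 ht.1.2.1 ht.2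
  obtain ⟨μ, hμ, hμpos, hμ1, hμ2⟩ := exists_mem_relMinima_pos_le hdeg hσ₂ haI ha0
  have hμM : μ ∈ posRelMinima σ₁ σ₂ I := ⟨hμ, hμpos⟩
  have hμlt : ‖σ₂ μ‖ < ‖σ₂ (voronoiChain σ₁ σ₂ I x₀ i)‖ := lt_of_le_of_lt hμ2 h2
  have hne : voronoiChain σ₁ σ₂ I x₀ i ≠ μ := fun h => by rw [h] at hμlt; exact lt_irrefl _ hμlt
  have hσlt : σ₁ (voronoiChain σ₁ σ₂ I x₀ i) < σ₁ μ :=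
    (relMinima_lt_iff hdeg hσ₂ ht.1 hμ ht.2 hμpos hne).mpr hμlt
  have hnxt := (voronoiSucc_spec hdeg hσ₂ ε hε ht).2.2 μ hμM hσlt
  rw [voronoiChain_succ hdeg hσ₂ ε hε hx₀]
  have hsqrt : 1 ≤ Real.sqrt |(NumberField.discr K : ℝ)| := by
    rw [Real.one_le_sqrt]
    have h := NumberField.abs_discr_gt_two (K := K) (by rw [hdeg]; norm_num)
    have : (2 : ℝ) < |(NumberField.discr K : ℝ)| := by rw [← Int.cast_abs]; exact_mod_cast h
    linarith
  have hX : 2 * Real.sqrt |(NumberField.discr K : ℝ)| / Real.pi + 1 ≤ 3 * Real.sqrt |(NumberField.discr K : ℝ)| := by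
    have hpi := Real.pi_gt_three
    rw [div_add_one (ne_of_gt (by linarith)), div_le_iff₀ (by linarith)]
    nlinarith
  have hpos := ht.2
  calc σ₁ (voronoiSucc σ₁ σ₂ I (voronoiChain σ₁ σ₂ I x₀ i)) ≤ σ₁ μ := hnxt
    _ ≤ |σ₁ a| := hμ1
    _ ≤ (2 * Real.sqrt |(NumberField.discr K : ℝ)| / Real.pi + 1) * σ₁ (voronoiChain σ₁ σ₂ I x₀ i) := h1.le
    _ ≤ 3 * Real.sqrt |(NumberField.discr K : ℝ)| * σ₁ (voronoiChain σ₁ σ₂ I x₀ i) :=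
        mul_le_mul_of_nonneg_right hX hpos.le

end Minkowski

/-! ### The assembled chain theorem (= the registered stub `stub_voronoiChain`, S3a) -/

/-- **The Voronoi chain of a fractional ideal of a cubic field of signature (1,1).** From the packing
S1 (h1) and the unit S2 (h2): for a cubic number field `K` with a real embedding `σ₁` and a non-real
embedding `σ₂` and a nonzero fractional ideal `I`, the relative minima of `I` with `σ₁ > 0` are a
strictly `σ₁`-increasing, `‖σ₂‖`-decreasing two-sided sequence `θ : ℤ → I` containing all of them,
purely periodic (`θ (i + n) = ε θ i`, `n ≥ 1`) under the unit `ε` of h2 (`σ₁ ε > 1`,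
`log σ₁ ε = regulator K`), with the six-gap `σ₁ θ(i+6) ≥ 2 σ₁ θ(i)` and the Minkowski gap bound
`σ₁ θ(i+1) ≤ 3 √|d_K| σ₁ θ(i)`. [Voronoi 1896; Delone–Faddeev 1964 Ch. IV; Buchmann–Williams 1988 §2] -/
theorem stub_voronoiChain :
    (∀ (K : Type) [Field K] (σ₁ : K →+* ℝ) (σ₂ : K →+* ℂ) (L : AddSubgroup K) (t : ℝ),
      0 < t → Set.encard {θ : K | θ ∈ L ∧ θ ≠ 0 ∧
        (∀ φ ∈ L, φ ≠ 0 → |σ₁ φ| < |σ₁ θ| → ‖σ₂ θ‖ ≤ ‖σ₂ φ‖) ∧ t ≤ σ₁ θ ∧ σ₁ θ < 2 * t} ≤ 6) →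
    (∀ (K : Type) [Field K] [NumberField K], Module.finrank ℚ K = 3 →
      ∀ (σ₁ : K →+* ℝ) (σ₂ : K →+* ℂ), (∃ z : K, starRingEnd ℂ (σ₂ z) ≠ σ₂ z) →
      ∃ ε : (𝓞 K)ˣ, 1 < σ₁ ((ε : 𝓞 K) : K) ∧
        Real.log (σ₁ ((ε : 𝓞 K) : K)) = NumberField.Units.regulator K ∧
        ∀ u : (𝓞 K)ˣ, 1 < σ₁ ((u : 𝓞 K) : K) → σ₁ ((ε : 𝓞 K) : K) ≤ σ₁ ((u : 𝓞 K) : K)) →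
    ∀ (K : Type) [Field K] [NumberField K], Module.finrank ℚ K = 3 →
    ∀ (σ₁ : K →+* ℝ) (σ₂ : K →+* ℂ), (∃ z : K, starRingEnd ℂ (σ₂ z) ≠ σ₂ z) →
    ∀ I : FractionalIdeal (nonZeroDivisors (𝓞 K)) K, I ≠ 0 →
    ∃ (θ : ℤ → K) (n : ℕ) (ε : (𝓞 K)ˣ),
      (∀ i, θ i ∈ I ∧ 0 < σ₁ (θ i)) ∧
      StrictMono (fun i => σ₁ (θ i)) ∧
      (∀ i, ‖σ₂ (θ (i + 1))‖ < ‖σ₂ (θ i)‖) ∧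
      (∀ i, ∀ φ ∈ I, φ ≠ 0 → |σ₁ φ| < |σ₁ (θ i)| → ‖σ₂ (θ i)‖ ≤ ‖σ₂ φ‖) ∧
      (∀ φ ∈ I, φ ≠ 0 → 0 < σ₁ φ →
        (∀ ψ ∈ I, ψ ≠ 0 → |σ₁ ψ| < |σ₁ φ| → ‖σ₂ φ‖ ≤ ‖σ₂ ψ‖) → ∃ i, θ i = φ) ∧
      0 < n ∧ 1 < σ₁ ((ε : 𝓞 K) : K) ∧
      Real.log (σ₁ ((ε : 𝓞 K) : K)) = NumberField.Units.regulator K ∧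
      (∀ i, θ (i + n) = ((ε : 𝓞 K) : K) * θ i) ∧
      (∀ i, 2 * σ₁ (θ i) ≤ σ₁ (θ (i + 6))) ∧
      (∀ i, σ₁ (θ (i + 1)) ≤ 3 * Real.sqrt |(NumberField.discr K : ℝ)| * σ₁ (θ i)) := by
  intro h1 h2 K _ _ hdeg σ₁ σ₂ hσ₂ I hI
  obtain ⟨ε, hε, hreg, -⟩ := h2 K hdeg σ₁ σ₂ hσ₂
  have hne := posRelMinima_nonempty (σ₁ := σ₁) (σ₂ := σ₂) hdeg hσ₂ hI
  obtain ⟨x₀, hx₀⟩ := hne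
  obtain ⟨c, hc⟩ := voronoiChain_periodic hdeg hσ₂ ε hε hx₀ ε (by linarith)
  have hcpos := voronoiChain_shift_pos hdeg hσ₂ ε hε hx₀ ε hε hc
  refine ⟨voronoiChain σ₁ σ₂ I x₀, c.toNat, ε, fun i => ?_, voronoiChain_strictMono hdeg hσ₂ ε hε hx₀, fun i => ?_,
    fun i => (voronoiChain_mem hdeg hσ₂ ε hε hx₀ i).1.2.2, fun φ hφ h0 hpos hmin => ?_, by omega, hε, hreg,
    fun i => ?_, fun i => voronoiChain_six_gap hdeg hσ₂ ε hε h1 hx₀ i, fun i => voronoiChain_gap_le hdeg hσ₂ ε hε hI hx₀ i⟩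
  · exact ⟨(voronoiChain_mem hdeg hσ₂ ε hε hx₀ i).1.1, (voronoiChain_mem hdeg hσ₂ ε hε hx₀ i).2⟩
  · have hm := voronoiChain_mem hdeg hσ₂ ε hε hx₀ i
    have hm' := voronoiChain_mem hdeg hσ₂ ε hε hx₀ (i + 1)
    have hlt : σ₁ (voronoiChain σ₁ σ₂ I x₀ i) < σ₁ (voronoiChain σ₁ σ₂ I x₀ (i + 1)) :=
      voronoiChain_strictMono hdeg hσ₂ ε hε hx₀ (lt_add_one i)
    have hne' : voronoiChain σ₁ σ₂ I x₀ i ≠ voronoiChain σ₁ σ₂ I x₀ (i + 1) := fun h => by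
      rw [h] at hlt; exact lt_irrefl _ hlt
    exact (relMinima_lt_iff hdeg hσ₂ hm.1 hm'.1 hm.2 hm'.2 hne').mp hlt
  · exact exists_voronoiChain_eq hdeg hσ₂ ε hε hx₀ ⟨⟨hφ, h0, hmin⟩, hpos⟩
  · rw [Int.toNat_of_nonneg hcpos.le]
    exact hc i

end Summit.QuantumAdvantage.QuantumAdvantage.Theorems.LinnikCubicClassGroups
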